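import Summits.BirchSwinnertonDyer.Rank1Residual.X11b.KolyvaginShaAtPrimeOfGross1991
import Summits.BirchSwinnertonDyer.BirchSwinnertonDyer.Theorems.GrossProp82OfPoitouTate
import Literature.NumberTheory.EllipticCurves.HeegnerPointsKolyvaginClassesPointsProofs
import Literature.NumberTheory.EllipticCurves.GrossLMS1991.HeegnerEulerSystemCongruenceImageFree
import HarnessLib

/-!
# Kolyvagin's theorem in KERNEL FORM modulo {Gross 1991 Prop. 3.7 (2), GZ86 III (3.1)}: the leaf
# `Gross1991_kolyvaginClasses` from x11b3's point-level END, RANK ONE of `E(K)`, and `kolyvagin N W K`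
# on its two small leaves (seat `bsd-wall-soed-p2-w2` g2; `--supports stmt-BirchSwinnertonDyer-20480`)

THEOREMS ONLY (no definition, no named fact, no `sorry`); `K : Type` (the universe of the tree's ring-class
class field theory and of the Poitou–Tate discharge). BSD is not proved by any of this; what moves is the trust
base of the named fact `kolyvagin` (Kolyvagin 1990 Thm. A / Gross 1991 Thm. 1.3) — conjunct (i) of the print stub
`stub_inputsPrim` of line `birth` v3 of crux Ko `WildKolyvaginUpperAtThree` (stmt-BirchSwinnertonDyer-20480).

STATE BEFORE. `kolyvagin_of_fourLeaves` (Literature, 2026-08-15): `kolyvagin` ⟸ {`Gross1991_kolyvaginClasses`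
(Gross §§3–6), `Gross1991_prop_8_2` (§§7–8), `Kolyvagin1990_sha_primary_finite`, `Kolyvagin1990_thmA_of_hasCM_or_discr`};
`GrossProp82OfPoitouTate.gross1991_prop_8_2_holds` (this seat, p589739) discharged the second leaf. Meanwhile
cell `b2b-bsdres` (x11b3-p2 GEN 54) proved the POINT-LEVEL root END
`KolyvaginAssembly.hpoints_at_of_perLevelChoice_of_gross1991E0_of_prop37`: for `E = W/ℚ` globally minimal
without CM at `N = N_E`, `K` imaginary quadratic Heegner with `d_K ∉ {−3,−4}`, a Heegner point `P`, `p` odd with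
`ρ̄_{E,p}` onto — at every level `p^M`, Kolyvagin's points `P_m` with Gross's Prop. 5.4 (1) congruence,
Prop. 6.2 (1) at the finite places `v ∤ m` and Prop. 6.2 (2) at `λ ∣ ℓ ∣ m`, CONDITIONAL on exactly the two
named facts {`GrossLMS1991.prop37_2_reductionCongruence N W K p`, `Gross1991_heegnerPoint_sub_ratTorsion_mem_E0`}
(CM theory over ring class fields, Shimura reciprocity, Prop. 5.3, Čebotarev, Weil pairing, Poitou–Tate all
PROVED in the tree). Its level-`p` case (`M = 1`) is, clause for clause, the point-level input (P) of the tree's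
`Gross1991_kolyvaginClasses_of_points` (Literature, `HeegnerPointsKolyvaginClassesPointsProofs`).

THIS FILE.
* §1 `gross1991_kolyvaginClasses_of_gross1991E0_of_frobeniusCongruence` — **the leaf
  `Gross1991_kolyvaginClasses N W K` for globally minimal `W` at `N = N_W`**, from the two named facts (Gross
  3.7 (2) in the image-free form `GrossLMS1991.prop37_2_frobeniusCongruence`, which implies the b2b form at
  every `p`, and GZ86 III (3.1) as `Gross1991_heegnerPoint_sub_ratTorsion_mem_E0`): x11b3's END at `M = 1`,
  rewritten along `p ^ 1 = p`, Gross's (3.2) `Frob(ℓ) = Frob(∞)` on `K(E[p])` read off the last conjunct of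
  `IsKolyvaginPrime`, the `a = 0` instance of the END's Prop. 6.2 (2) clause.
* §2 `gross1991_prop_2_1_of_…`, `mordellWeilRank_eq_one_of_gross1991E0_of_frobeniusCongruence` — Gross's
  Prop. 2.1 and **rank `E(K) = 1`** (Kolyvagin Thm. A (1)) for such `(W, N, K)` with a NON-TORSION Heegner point,
  from the same two facts: `Gross1991_prop_2_1_of_kolyvaginClasses_of_prop_8_2` (§§9–10 + Čebotarev PROVED) with
  §1 and `gross1991_prop_8_2_holds`, then `mordellWeilRank_eq_one_and_sha_cofinite_of_prop_2_1` with Serre's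
  open image theorem (`serre_open_image_holds`).
* §3 `kolyvagin_of_gross1991E0_of_frobeniusCongruence_of_twoLeaves` — `kolyvagin N W K` for globally minimal `W`
  at `N = N_W` from the two facts + the two SMALL leaves `Kolyvagin1990_sha_primary_finite N W K` (`Ш(E/K)[p^∞]`
  finite at EVERY `p` — the tree has it at every odd surjective `p`, x11b3 GEN 54, not at the finitely many
  others) and `Kolyvagin1990_thmA_of_hasCM_or_discr N W K` (vacuous off CM / `d_K ∈ {−3,−4}`).
Net (honest): on the wild-at-3 cell of crux Ko (globally minimal, `ρ̄₃` onto hence non-CM, `d_K` odd `≠ −3`),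
RANK ONE of `E(K)` and (x11b3) the finiteness of `Ш(E/K)[3^∞]` are kernel theorems modulo {3.7 (2), GZ86 III
(3.1)} — the two facts the line's McCallum road needs anyway; the sibling file
`SemiOrdinaryEisensteinDescentWildKolyvaginUpperAtThreeOfThreePrimitives` removes `kolyvagin` from Ko's composition.

References: [GrossLMS1991] §1 Thm. 1.3, §2 Props. 2.1, 2.3, §3 (3.1)–(3.2), Prop. 3.7 (2), §4 (4.1), (4.4),
Prop. 5.4, §6 Prop. 6.2, §8 Prop. 8.2, §§9–10; [McCallumLMS1991] §1 Theorem (Kolyvagin), §3 Cor. 3.2, §4;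
[GrossZagier1986] III (3.1); [Serre1972] §4.2 Thm. 2; [KolyvaginEulerSystems1990] Thm. A.
-/

set_option autoImplicit false
set_option linter.dupNamespace false -- `Summit.BirchSwinnertonDyer.BirchSwinnertonDyer.…` is the tree's layout (D-0017)

noncomputable section

open scoped Classical

namespace Summit.BirchSwinnertonDyer.BirchSwinnertonDyer.Theorems.KolyvaginRankOneOfGross1991E0Prop37

open WeierstrassCurve NumberField IsDedekindDomain Field
open Literature.NumberTheory.EllipticCurves Literature.NumberTheory.GaloisRepresentations
open Literature.NumberTheory.EllipticCurves.GrossLMS1991 (prop37_2_reductionCongruence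
  prop37_2_frobeniusCongruence prop37_2_reductionCongruence_of_frobeniusCongruence)
open Summit.BirchSwinnertonDyer.Rank1Residual.X11b
open Summit.BirchSwinnertonDyer.Rank1Residual.X11b.KolyvaginAssembly
open Summit.BirchSwinnertonDyer.BirchSwinnertonDyer.Theorems.GrossProp82OfPoitouTate

variable {K : Type} [Field K] [NumberField K] (N : ℕ) [NeZero N] (W : WeierstrassCurve ℚ) [W.IsGloballyMinimal]

/-! ## §1 The leaf `Gross1991_kolyvaginClasses` for globally minimal `W` at `N = N_W` -/

/-- **Kolyvagin's classes `c(n)` with Gross's Props. 5.4 (2) and 6.2 — the named leaf `Gross1991_kolyvaginClasses N W K`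
— for `E = W/ℚ` GLOBALLY MINIMAL at `N = N_E` and every number field `K : Type`, from Gross 1991 Prop. 3.7 (2)
(image-free print, `GrossLMS1991.prop37_2_frobeniusCongruence`) and GZ86 III (3.1) (`Gross1991_heegnerPoint_sub_ratTorsion_mem_E0`).**
x11b3's point-level END `hpoints_at_of_perLevelChoice_of_gross1991E0_of_prop37` at `M = 1` (rewritten along
`p ^ 1 = p`; its extra conclusion `c P − ε P` torsion dropped; its clause 6.2 (2) taken at `a = 0`; its binder
`Frob(q) = Frob(∞)` on `K(E[p])` = the last conjunct of `IsKolyvaginPrime`, Gross (3.2)) IS the point-level input (P)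
of `Gross1991_kolyvaginClasses_of_points`. CONDITIONAL on the two named facts and `hN`.
[cite: GrossLMS1991, §3 (3.1)–(3.2), Prop. 3.7 (2), §4 (4.1), (4.4), Prop. 5.4, §6 Prop. 6.2]
[cite: McCallumLMS1991, §4 (4)–(6), Lemma 4.1] [cite: GrossZagier1986, III (3.1)] -/
theorem gross1991_kolyvaginClasses_of_gross1991E0_of_frobeniusCongruence (K : Type) [Field K] [NumberField K]
    (hN : ∀ [W.IsElliptic], N = W.conductorNorm ℤ)
    (hE0 : Gross1991_heegnerPoint_sub_ratTorsion_mem_E0) (h372 : prop37_2_frobeniusCongruence) :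
    Gross1991_kolyvaginClasses N W K := by
  refine Gross1991_kolyvaginClasses_of_points N W K ?_
  intro _ hE hK hD hH P hP p hp hp2 hρ hdiv c hc
  have h := hpoints_at_of_perLevelChoice_of_gross1991E0_of_prop37 (K := K) hN hE hK hD hH hP hp hp2 hρ hE0
    (prop37_2_reductionCongruence_of_frobeniusCongruence h372 N W K p) (M := 1) le_rfl
  rw [pow_one] at h
  obtain ⟨ε, τ, hτ, A, hA, Pt, hPt, hε, -, hAτ, hPt1, hm⟩ := h hdiv c hc
  refine ⟨ε, τ, hτ, A, hA, Pt, hPt, hε, hAτ, hPt1, fun m hsq hkol ↦ ?_⟩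
  obtain ⟨h1, h2, h3⟩ := hm m hsq (fun q hq ↦ ⟨hkol q hq, (hkol q hq).2.2.2.2.2⟩)
  refine ⟨h1, h2, fun ℓ hℓ hℓm v hv ↦ ?_⟩
  simpa only [pow_zero, one_smul] using h3 ℓ hℓ hℓm v hv 0

/-! ## §2 Gross's Prop. 2.1 and RANK ONE -/

/-- **Gross 1991, Prop. 2.1 (`Sel_p(E/K) = ⟨δ y_K⟩` for odd surjective `p ∤ [E(K) : ℤ y_K]`) as the named fact
`Gross1991_prop_2_1 N W K`, for globally minimal `W` at `N = N_W`, from {3.7 (2), GZ86 III (3.1)}** — the tree's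
`Gross1991_prop_2_1_of_kolyvaginClasses_of_prop_8_2` (Gross §§9–10, McCallum Cor. 3.2 by Čebotarev, all PROVED) with
§1 and `gross1991_prop_8_2_holds`. CONDITIONAL on the two named facts and `hN`.
[cite: GrossLMS1991, §2 Prop. 2.1, §§9–10] [cite: McCallumLMS1991, §3 Cor. 3.2] -/
theorem gross1991_prop_2_1_of_gross1991E0_of_frobeniusCongruence (K : Type) [Field K] [NumberField K]
    (hN : ∀ [W.IsElliptic], N = W.conductorNorm ℤ)
    (hE0 : Gross1991_heegnerPoint_sub_ratTorsion_mem_E0) (h372 : prop37_2_frobeniusCongruence) :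
    Gross1991_prop_2_1 N W K :=
  Gross1991_prop_2_1_of_kolyvaginClasses_of_prop_8_2 N W K
    (gross1991_kolyvaginClasses_of_gross1991E0_of_frobeniusCongruence N W K hN hE0 h372)
    (gross1991_prop_8_2_holds N W K)

/-- **Kolyvagin's Theorem A (1): `rank E(K) = 1`** for `E = W/ℚ` globally minimal without CM at `N = N_E`, `K : Type`
imaginary quadratic with `d_K ∉ {−3, −4}` and the Heegner hypothesis for `N`, and a NON-TORSION Heegner point `P`
— a KERNEL theorem modulo {Gross 3.7 (2), GZ86 III (3.1)}: Prop. 2.1 (previous theorem) for almost all `p` by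
Serre's open image theorem (`serre_open_image_holds`) and Mordell–Weil
(`mordellWeilRank_eq_one_and_sha_cofinite_of_prop_2_1`, Gross §2). Also `Ш(E/K)[p] = 0` for almost all `p`.
[cite: GrossLMS1991, §1 Thm. 1.3 (1), §2 (Props. 2.1, 2.3 and the paragraph after Prop. 2.1)]
[cite: Serre1972, §4.2 Thm. 2] [cite: McCallumLMS1991, §1 Theorem (Kolyvagin)] -/
theorem mordellWeilRank_eq_one_of_gross1991E0_of_frobeniusCongruence [W.IsElliptic]
    (hN : N = W.conductorNorm ℤ)
    (hE0 : Gross1991_heegnerPoint_sub_ratTorsion_mem_E0) (h372 : prop37_2_frobeniusCongruence)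
    (hE : ¬ W.HasCM) (hK : IsImaginaryQuadratic K)
    (hD : NumberField.discr K ≠ -3 ∧ NumberField.discr K ≠ -4) (hH : SatisfiesHeegnerHypothesis N K)
    {P : (W.baseChange K).toAffine.Point} (hP : IsHeegnerPoint N W K P) (hnt : ¬ IsOfFinAddOrder P) :
    (W.baseChange K).mordellWeilRank = 1 ∧
      ∃ S : Finset ℕ, ∀ p : ℕ, p.Prime → p ∉ S → ∀ c : (W.baseChange K).sha, p • c = 0 → c = 0 :=
  mordellWeilRank_eq_one_and_sha_cofinite_of_prop_2_1 N W K
    (gross1991_prop_2_1_of_gross1991E0_of_frobeniusCongruence N W K hN hE0 h372)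
    serre_open_image_holds hE hK hD hH hP hnt

/-! ## §3 `kolyvagin N W K` on its two small leaves -/

/-- **Kolyvagin's theorem `kolyvagin N W K` for globally minimal `W` at `N = N_W` and `K : Type`, from {Gross 3.7 (2),
GZ86 III (3.1)} and the two SMALL leaves** `Kolyvagin1990_sha_primary_finite N W K` (`Ш(E/K)[p^∞]` finite at every
`p`; Gross Thm. 1.3 (2) beyond the sketch) and `Kolyvagin1990_thmA_of_hasCM_or_discr N W K` (the CM / `d_K ∈ {−3,−4}`
cases) — `kolyvagin_of_kolyvaginClasses_of_prop_8_2` with §1, `gross1991_prop_8_2_holds` and `serre_open_image_holds`.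
The two big leaves of `kolyvagin_of_fourLeaves` (Gross §§3–6 and §§7–8) are thereby replaced by the two print
facts the Kolyvagin–McCallum structure road already carries. CONDITIONAL on the displayed hypotheses.
[cite: GrossLMS1991, §1 Thm. 1.3, §2, Prop. 3.7 (2), §6, Prop. 8.2] [cite: KolyvaginEulerSystems1990, Thm. A]
[cite: McCallumLMS1991, §1 Theorem (Kolyvagin)] -/
theorem kolyvagin_of_gross1991E0_of_frobeniusCongruence_of_twoLeaves (K : Type) [Field K] [NumberField K]
    (hN : ∀ [W.IsElliptic], N = W.conductorNorm ℤ)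
    (hE0 : Gross1991_heegnerPoint_sub_ratTorsion_mem_E0) (h372 : prop37_2_frobeniusCongruence)
    (hSha : Kolyvagin1990_sha_primary_finite N W K) (hexc : Kolyvagin1990_thmA_of_hasCM_or_discr N W K) :
    kolyvagin N W K :=
  kolyvagin_of_kolyvaginClasses_of_prop_8_2 N W K
    (gross1991_kolyvaginClasses_of_gross1991E0_of_frobeniusCongruence N W K hN hE0 h372)
    (gross1991_prop_8_2_holds N W K) serre_open_image_holds hSha hexc

end Summit.BirchSwinnertonDyer.BirchSwinnertonDyer.Theorems.KolyvaginRankOneOfGross1991E0Prop37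

end
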